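import Mathlib
import HarnessLib

/-!
# The polar retraction onto complex structures in dimension four: the explicit formula
(helper file 2 for stub `stub_tameJ` of line `cross-cap-laurent`, crux `GromovRecognitionRelEnd`,
item stmt-SmoothPoincare4-11009)

McDuff–Salamon (2017), Prop. 2.5.6 / (4.1.3): for an inner product `g` and a nondegenerate skew
form `ω(v, w) = g(Av, w)`, the `g`-orthogonal polar part `J = A (-A²)^{-1/2}` of the `g`-skew
endomorphism `A` is an `ω`-compatible complex structure. In dimension `4`, if `A` satisfies the
(even) Cayley–Hamilton relation `A⁴ + τ A² + p = 0` (`τ = λ₁² + λ₂²`, `p = λ₁²λ₂²` for the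
spectrum `±iλ₁, ±iλ₂`), Lagrange interpolation of `t ↦ t^{-1/2}` at `λ₁², λ₂²` gives the closed
form

  `J = F(A, τ, p) := (√p · √(τ + 2√p))⁻¹ • (A (A² + (τ + √p) 1))`.

This file records the formal properties of `F` in an arbitrary (normed) real algebra `R` — they are
then used with `R = End(ℝ⁴) = (ℝ⁴ →L[ℝ] ℝ⁴)`:

* `polar_mul_self` — `F(A, τ, p)² = -1` from the Cayley–Hamilton relation with `p > 0`,
  `τ + 2√p > 0` (division of `X²(X² + τ + π)²` by `X⁴ + τX² + p`, `π = √p`, leaves `-p (τ + 2π)`);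
  its `End(ℝ⁴)` instance is the registered helper sub-goal `helper_polarMulSelf`;
* `polar_of_mul_self` — complex structures are fixed: `A² = -1 ⇒ F(A, 2, 1) = A`;
* `polar_conj` — conjugation equivariance `F(T A T', τ, p) = T F(A, τ, p) T'` (`T' T = 1`);
* `contDiffAt_polar` — `A ↦ F(A, τ(A), p(A))` is `C^n` at `A` for `C^n` scalar functions `τ, p`
  with `p(A) > 0`, `τ(A) + 2√p(A) > 0`;
* the trace invariants `τ(A) = -tr(A²)/2`, `p(A) = τ²/2 - tr(A⁴)/4` on `End(V)`, `V` a
  finite-dimensional real normed space: smoothness (`contDiff_trace`, `contDiff_tauTrace`,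
  `contDiff_pTrace`), conjugation invariance (`trace_conj`, `tauTrace_conj`, `pTrace_conj`) and
  their values `2`, `1` at a complex structure of `ℝ⁴` (`tauTrace_of_mul_self`, `pTrace_of_mul_self`).

Everything is proved; no definition, no named fact.

References: D. McDuff, D. Salamon, *Introduction to Symplectic Topology*, 3rd ed. (2017),
Prop. 2.5.6, §4.1 (4.1.3) [McDuffSalamon2017].
-/

noncomputable section

-- the registered namespace `Summit.SmoothPoincare4.SmoothPoincare4.Theorems…` repeats a component
set_option linter.dupNamespace false

open scoped Topology ContDiff

namespace Summit.SmoothPoincare4.SmoothPoincare4.Theorems.GromovRecognitionRelEnd.CrossCapLaurent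

/-! ### Algebra of the formula in a real algebra -/

section Algebra

variable {R : Type*} [Ring R] [Algebra ℝ R]

/-- **`F(A, τ, p)² = -1` under the Cayley–Hamilton relation** `A⁴ + τA² + p = 0` with
`p > 0`, `τ + 2√p > 0`: with `Q = A²`, `π = √p`, `d = τ + π`, `s² = τ + 2π` one has
`Q (Q + d)² = (Q² + τQ + p)(Q + 2d - τ) - p s² = -p s²`, so `F² = (πs)⁻² Q (Q + d)² = -1`.
McDuff–Salamon (2017), Prop. 2.5.6 (`J² = -1` for the polar part), made explicit in dimension
four. [cite: McDuffSalamon2017, Prop. 2.5.6] -/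
theorem polar_mul_self (A : R) {τ p : ℝ} (hp : 0 < p) (hs : 0 < τ + 2 * √p)
    (hCH : A * A * (A * A) + τ • (A * A) + p • (1 : R) = 0) :
    ((√p * √(τ + 2 * √p))⁻¹ • (A * (A * A + (τ + √p) • 1))) *
      ((√p * √(τ + 2 * √p))⁻¹ • (A * (A * A + (τ + √p) • 1))) = -1 := by
  set π := √p with hπ
  set s := √(τ + 2 * π) with hs'
  set d := τ + π with hd
  set Q := A * A with hQ
  have hππ : π * π = p := Real.mul_self_sqrt hp.le
  have hss : s * s = τ + 2 * π := Real.mul_self_sqrt hs.le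
  have hπ0 : π ≠ 0 := (Real.sqrt_pos.2 hp).ne'
  have hs0 : s ≠ 0 := (Real.sqrt_pos.2 hs).ne'
  have hQQ : Q * Q = (-τ) • Q + (-p) • (1 : R) := by
    have : Q * Q = -(τ • Q + p • 1) := by
      rw [eq_neg_iff_add_eq_zero, ← add_assoc]; exact hCH
    rw [this, neg_add, ← neg_smul, ← neg_smul]
  -- `A` commutes with `Q + d`
  have hcomm : (Q + d • 1) * A = A * (Q + d • 1) := by
    rw [add_mul, mul_add, smul_mul_assoc, one_mul, mul_smul_comm, mul_one, hQ, mul_assoc]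
  -- the square, reduced to the span of `Q` and `1`
  have hsq : (A * (Q + d • 1)) * (A * (Q + d • 1)) = (-(p * (s * s))) • (1 : R) := by
    have e1 : (A * (Q + d • 1)) * (A * (Q + d • 1)) = Q * ((Q + d • 1) * (Q + d • 1)) := by
      rw [mul_assoc, ← mul_assoc (Q + d • 1) A, hcomm, hQ]; simp only [mul_assoc]
    have e2 : (Q + d • (1 : R)) * (Q + d • 1) = (2 * d - τ) • Q + (d * d - p) • (1 : R) := by
      rw [add_mul, mul_add, mul_add, smul_mul_assoc, one_mul, mul_smul_comm, mul_one,
        smul_mul_smul_comm, one_mul, hQQ]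
      module
    have e3 : Q * ((2 * d - τ) • Q + (d * d - p) • (1 : R)) =
        ((2 * d - τ) * (-τ) + (d * d - p)) • Q + ((2 * d - τ) * (-p)) • (1 : R) := by
      rw [mul_add, mul_smul_comm, mul_smul_comm, mul_one, hQQ]
      module
    rw [e1, e2, e3]
    have c1 : (2 * d - τ) * (-τ) + (d * d - p) = 0 := by
      rw [hd, ← hππ]; ring
    have c2 : (2 * d - τ) * (-p) = -(p * (s * s)) := by
      rw [hd, hss]; ring
    rw [c1, c2]
    module
  rw [smul_mul_smul_comm, hsq, smul_smul]
  have : (π * s)⁻¹ * (π * s)⁻¹ * -(p * (s * s)) = -1 := by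
    rw [← hππ]; field_simp
  rw [this]
  module

/-- **Complex structures are fixed by the polar retraction**: if `A² = -1` then
`F(A, 2, 1) = A` (at a complex structure of `ℝ⁴` the invariants are `τ = 2`, `p = 1`, so
`π = 1`, `s = 2` and `A(A² + 3)/2 = A`). In particular the retraction is the identity on
`ψ*(i ⊕ i)` over the end. [cite: McDuffSalamon2017, Prop. 2.5.6] -/
theorem polar_of_mul_self (A : R) (h : A * A = -1) :
    (√(1 : ℝ) * √((2 : ℝ) + 2 * √(1 : ℝ)))⁻¹ • (A * (A * A + ((2 : ℝ) + √(1 : ℝ)) • 1)) = A := by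
  have h4 : √(4 : ℝ) = 2 := by
    rw [show (4 : ℝ) = 2 ^ 2 by norm_num, Real.sqrt_sq (by norm_num)]
  have key : A * (A * A + ((2 : ℝ) + 1) • (1 : R)) = (2 : ℝ) • A := by
    rw [h, mul_add, mul_smul_comm, mul_one, mul_neg_one]
    module
  rw [Real.sqrt_one, show (2 : ℝ) + 2 * 1 = 4 by norm_num, h4, key, smul_smul]
  norm_num

omit [Algebra ℝ R] in
/-- `T' (T X) = X` when `T' T = 1`. [folklore] -/
private theorem cancel_left {T T' : R} (h : T' * T = 1) (X : R) : T' * (T * X) = X := by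
  rw [← mul_assoc, h, one_mul]

omit [Algebra ℝ R] in
/-- Conjugation is multiplicative: `(T A T') (T B T') = T (A B) T'` for `T' T = 1`. [folklore] -/
theorem conj_mul_conj {T T' : R} (h : T' * T = 1) (A B : R) :
    T * (A * T') * (T * (B * T')) = T * (A * B * T') := by
  simp only [mul_assoc, cancel_left h]

/-- **`F` is conjugation-equivariant**: `F(T A T', τ, p) = T F(A, τ, p) T'` whenever
`T' T = 1` — the formula is a polynomial in `A` with scalar coefficients. (With the conjugation
invariance of `τ(A)`, `p(A)` this is the hypothesis of the packaging lemma
`contMDiff_endSection_map`.) [cite: McDuffSalamon2017, Prop. 2.5.6] -/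
theorem polar_conj (T T' A : R) (hT'T : T' * T = 1) (τ p : ℝ) :
    (√p * √(τ + 2 * √p))⁻¹ •
        (T * (A * T') * (T * (A * T') * (T * (A * T')) + (τ + √p) • 1)) =
      T * ((√p * √(τ + 2 * √p))⁻¹ • (A * (A * A + (τ + √p) • 1)) * T') := by
  rw [conj_mul_conj hT'T, smul_mul_assoc, mul_smul_comm]
  congr 1
  simp only [mul_add, add_mul, mul_smul_comm, smul_mul_assoc, mul_one, mul_assoc, cancel_left hT'T]

end Algebra

/-! ### Smoothness of the formula in a normed algebra -/

section Smooth

variable {R : Type*} [NormedRing R] [NormedAlgebra ℝ R] {n : WithTop ℕ∞}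

/-- **`A ↦ F(A, τ(A), p(A))` is `C^n`** at a point where the `C^n` scalar functions `τ, p` satisfy
`p(A) > 0`, `τ(A) + 2√p(A) > 0` (square roots of positive smooth functions, inverse of a
nonvanishing one, products in the normed algebra). The "smooth dependence" clause of
McDuff–Salamon (2017), Prop. 2.5.6, in closed form. [cite: McDuffSalamon2017, Prop. 2.5.6] -/
theorem contDiffAt_polar {τ p : R → ℝ} {A : R} (hτ : ContDiffAt ℝ n τ A) (hp : ContDiffAt ℝ n p A)
    (h1 : 0 < p A) (h2 : 0 < τ A + 2 * √(p A)) :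
    ContDiffAt ℝ n
      (fun B ↦ (√(p B) * √(τ B + 2 * √(p B)))⁻¹ • (B * (B * B + (τ B + √(p B)) • 1))) A := by
  have hπ : ContDiffAt ℝ n (fun B ↦ √(p B)) A := hp.sqrt h1.ne'
  have hs : ContDiffAt ℝ n (fun B ↦ √(τ B + 2 * √(p B))) A :=
    (hτ.add (contDiffAt_const.mul hπ)).sqrt h2.ne'
  have hc : ContDiffAt ℝ n (fun B ↦ (√(p B) * √(τ B + 2 * √(p B)))⁻¹) A := by
    refine (hπ.mul hs).inv ?_
    exact mul_ne_zero (Real.sqrt_pos.2 h1).ne' (Real.sqrt_pos.2 h2).ne'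
  refine hc.smul (contDiffAt_id.mul ((contDiffAt_id.mul contDiffAt_id).add ?_))
  exact (hτ.add hπ).smul contDiffAt_const

end Smooth

/-! ### The trace invariants `τ(A) = -tr(A²)/2`, `p(A) = τ²/2 - tr(A⁴)/4` -/

section Trace

variable {V : Type*} [NormedAddCommGroup V] [NormedSpace ℝ V] [FiniteDimensional ℝ V]
  {n : WithTop ℕ∞}

/-- The trace `A ↦ tr A` is smooth on `End(V)` (a linear functional on a finite-dimensional
space). [folklore] -/
theorem contDiff_trace : ContDiff ℝ n fun A : V →L[ℝ] V ↦ LinearMap.trace ℝ V (A : V →ₗ[ℝ] V) :=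
  (LinearMap.toContinuousLinearMap
    ((LinearMap.trace ℝ V) ∘ₗ ContinuousLinearMap.coeLM ℝ)).contDiff

/-- `τ(A) = -tr(A²)/2` is smooth. [folklore] -/
theorem contDiff_tauTrace :
    ContDiff ℝ n fun A : V →L[ℝ] V ↦ -(LinearMap.trace ℝ V ((A * A : V →L[ℝ] V) : V →ₗ[ℝ] V)) / 2 :=
  ((contDiff_trace.comp (contDiff_id.mul contDiff_id)).neg).div_const 2

/-- `p(A) = τ(A)²/2 - tr(A⁴)/4` is smooth. [folklore] -/
theorem contDiff_pTrace :
    ContDiff ℝ n fun A : V →L[ℝ] V ↦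
      (-(LinearMap.trace ℝ V ((A * A : V →L[ℝ] V) : V →ₗ[ℝ] V)) / 2) ^ 2 / 2 -
        LinearMap.trace ℝ V ((A * A * (A * A) : V →L[ℝ] V) : V →ₗ[ℝ] V) / 4 :=
  ((contDiff_tauTrace.pow 2).div_const 2).sub
    ((contDiff_trace.comp ((contDiff_id.mul contDiff_id).mul (contDiff_id.mul contDiff_id))).div_const
      4)

/-- **Conjugation invariance of the trace**: `tr (T A T') = tr A` when `T' T = 1`
(`tr (T (A T')) = tr ((A T') T)`). [folklore] -/
theorem trace_conj (T T' A : V →L[ℝ] V) (h : T' * T = 1) :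
    LinearMap.trace ℝ V ((T * (A * T') : V →L[ℝ] V) : V →ₗ[ℝ] V) =
      LinearMap.trace ℝ V (A : V →ₗ[ℝ] V) := by
  have h' : (T' : V →ₗ[ℝ] V) ∘ₗ (T : V →ₗ[ℝ] V) = LinearMap.id :=
    LinearMap.ext fun v ↦ congrArg (fun f : V →L[ℝ] V ↦ f v) h
  have : ((T * (A * T') : V →L[ℝ] V) : V →ₗ[ℝ] V) =
      (T : V →ₗ[ℝ] V) ∘ₗ ((A : V →ₗ[ℝ] V) ∘ₗ (T' : V →ₗ[ℝ] V)) := rfl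
  rw [this, LinearMap.trace_comp_comm', LinearMap.comp_assoc, h', LinearMap.comp_id]

/-- `τ` is a conjugation invariant. [folklore] -/
theorem tauTrace_conj (T T' A : V →L[ℝ] V) (h : T' * T = 1) :
    -(LinearMap.trace ℝ V ((T * (A * T') * (T * (A * T')) : V →L[ℝ] V) : V →ₗ[ℝ] V)) / 2 =
      -(LinearMap.trace ℝ V ((A * A : V →L[ℝ] V) : V →ₗ[ℝ] V)) / 2 := by
  rw [conj_mul_conj h, trace_conj T T' _ h]

/-- `p` is a conjugation invariant. [folklore] -/
theorem pTrace_conj (T T' A : V →L[ℝ] V) (h : T' * T = 1) :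
    (-(LinearMap.trace ℝ V ((T * (A * T') * (T * (A * T')) : V →L[ℝ] V) : V →ₗ[ℝ] V)) / 2) ^ 2 /
          2 -
        LinearMap.trace ℝ V
            ((T * (A * T') * (T * (A * T')) * (T * (A * T') * (T * (A * T'))) : V →L[ℝ] V) :
              V →ₗ[ℝ] V) / 4 =
      (-(LinearMap.trace ℝ V ((A * A : V →L[ℝ] V) : V →ₗ[ℝ] V)) / 2) ^ 2 / 2 -
        LinearMap.trace ℝ V ((A * A * (A * A) : V →L[ℝ] V) : V →ₗ[ℝ] V) / 4 := by
  rw [conj_mul_conj h, conj_mul_conj h, trace_conj T T' _ h, trace_conj T T' _ h]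

/-- The trace of the identity of `ℝ⁴` is `4`. [folklore] -/
theorem trace_one_euclideanSpace_four :
    LinearMap.trace ℝ (EuclideanSpace ℝ (Fin 4))
        ((1 : EuclideanSpace ℝ (Fin 4) →L[ℝ] EuclideanSpace ℝ (Fin 4)) :
          EuclideanSpace ℝ (Fin 4) →ₗ[ℝ] EuclideanSpace ℝ (Fin 4)) = 4 := by
  have : ((1 : EuclideanSpace ℝ (Fin 4) →L[ℝ] EuclideanSpace ℝ (Fin 4)) :
      EuclideanSpace ℝ (Fin 4) →ₗ[ℝ] EuclideanSpace ℝ (Fin 4)) = 1 := rfl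
  rw [this, LinearMap.trace_one, finrank_euclideanSpace_fin]
  norm_num

/-- At a complex structure of `ℝ⁴` (`A² = -1`), `τ(A) = 2`. [folklore] -/
theorem tauTrace_of_mul_self {A : EuclideanSpace ℝ (Fin 4) →L[ℝ] EuclideanSpace ℝ (Fin 4)}
    (h : A * A = -1) :
    -(LinearMap.trace ℝ (EuclideanSpace ℝ (Fin 4))
        ((A * A : EuclideanSpace ℝ (Fin 4) →L[ℝ] EuclideanSpace ℝ (Fin 4)) :
          EuclideanSpace ℝ (Fin 4) →ₗ[ℝ] EuclideanSpace ℝ (Fin 4))) / 2 = 2 := by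
  rw [h]
  have : ((-1 : EuclideanSpace ℝ (Fin 4) →L[ℝ] EuclideanSpace ℝ (Fin 4)) :
      EuclideanSpace ℝ (Fin 4) →ₗ[ℝ] EuclideanSpace ℝ (Fin 4)) =
        -((1 : EuclideanSpace ℝ (Fin 4) →L[ℝ] EuclideanSpace ℝ (Fin 4)) :
          EuclideanSpace ℝ (Fin 4) →ₗ[ℝ] EuclideanSpace ℝ (Fin 4)) := rfl
  rw [this, map_neg, trace_one_euclideanSpace_four]
  norm_num

/-- At a complex structure of `ℝ⁴` (`A² = -1`), `p(A) = 1`. [folklore] -/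
theorem pTrace_of_mul_self {A : EuclideanSpace ℝ (Fin 4) →L[ℝ] EuclideanSpace ℝ (Fin 4)}
    (h : A * A = -1) :
    (-(LinearMap.trace ℝ (EuclideanSpace ℝ (Fin 4))
          ((A * A : EuclideanSpace ℝ (Fin 4) →L[ℝ] EuclideanSpace ℝ (Fin 4)) :
            EuclideanSpace ℝ (Fin 4) →ₗ[ℝ] EuclideanSpace ℝ (Fin 4))) / 2) ^ 2 / 2 -
        LinearMap.trace ℝ (EuclideanSpace ℝ (Fin 4))
          ((A * A * (A * A) : EuclideanSpace ℝ (Fin 4) →L[ℝ] EuclideanSpace ℝ (Fin 4)) :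
            EuclideanSpace ℝ (Fin 4) →ₗ[ℝ] EuclideanSpace ℝ (Fin 4)) / 4 = 1 := by
  rw [tauTrace_of_mul_self h]
  have h4 : A * A * (A * A) = 1 := by
    rw [h, neg_mul_neg (1 : EuclideanSpace ℝ (Fin 4) →L[ℝ] EuclideanSpace ℝ (Fin 4)) 1, one_mul]
  rw [h4, trace_one_euclideanSpace_four]
  norm_num

end Trace

/-! ### Registered helper sub-goal -/

/-- **Registered helper sub-goal `helper_polarMulSelf`** (`polar_mul_self` in `End(ℝ⁴)`): an
endomorphism `A` of `ℝ⁴` with `A⁴ + τA² + p = 0`, `p > 0`, `τ + 2√p > 0` has the complex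
structure `F(A, τ, p) = (√p √(τ + 2√p))⁻¹ A (A² + (τ + √p))`: `F² = -1`.
[cite: McDuffSalamon2017, Prop. 2.5.6] -/
theorem helper_polarMulSelf : ∀ (A : EuclideanSpace ℝ (Fin 4) →L[ℝ] EuclideanSpace ℝ (Fin 4))
    (τ p : ℝ), 0 < p → 0 < τ + 2 * √p →
    A * A * (A * A) + τ • (A * A) +
        p • (1 : EuclideanSpace ℝ (Fin 4) →L[ℝ] EuclideanSpace ℝ (Fin 4)) = 0 →
    ((√p * √(τ + 2 * √p))⁻¹ • (A * (A * A + (τ + √p) • 1))) *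
      ((√p * √(τ + 2 * √p))⁻¹ • (A * (A * A + (τ + √p) • 1))) = -1 :=
  fun A _ _ hp hs hCH ↦ polar_mul_self A hp hs hCH

end Summit.SmoothPoincare4.SmoothPoincare4.Theorems.GromovRecognitionRelEnd.CrossCapLaurent

end
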